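import Literature.MathematicalPhysics.QuantumManyBody.PeriodicBoseGasPQ
import HarnessLib

/-!
# Fournais 2020, Lemma 2.4 in first quantisation: the operators `b_p` on the `n`-particle sector

Topic `Literature/MathematicalPhysics/QuantumManyBody`, sibling of `PeriodicBoseGasSectorOps.lean`
(provefact `Literature.MathematicalPhysics.QuantumManyBody.BoseGas.Fournais2020_condensation`, layer
`Fournais2020_lemma24`). The proof of [Fournais2020, Lemma 2.4] ("the analysis of this term uses
second quantization", (2.27)–(2.42)) works with the operators
`b_k = ℓ^{-3/2} a₀† a(Qχ_Λe^{-ikx})`, `a₀ = ℓ^{-3/2}a(θ)`, `θ = 1_Λ` (2.27) on the bosonic Fock space.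
They preserve the particle number, so everything happens on the fixed `n`-particle sector
`L²(Λⁿ)`, where `a†(f)a(g) = ∑ᵢ |f⟩⟨g|ᵢ`. This file writes the resulting objects as functions on
`Λⁿ` (no Fock space), in Mathlib's Fourier convention `𝓕f(p) = ∫e^{-2πi⟨y,p⟩}f(y)dy`
(the paper's momentum is `k = 2πp`, so `(2π)⁻³∫dk = ∫dp` and `k² = 4π²|p|²`):

* `sliceExc χ ℓ u i Φ X = χ_Λ · Q(Φ(X; ·ᵢ))` — the localised excited `i`-th slice, the function
  whose Fourier transform enters `T` (2.7) (`kinLoc`); `excAmp … X p = 𝓕(sliceExc … X)(p)`;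
* `bVec χ ℓ u p Φ X = ℓ⁻³ ∑ᵢ 𝓕(χ_Λ QᵢΦ(X;·ᵢ))(p)` — the function `b_{-k}Φ` (2.27) at `k = 2πp`
  (`(a†(θ)a(Qχ_Λe^{-ik·})Φ)(X) = ∑ᵢ θ(xᵢ)∫χ_Λ(y)e^{iky}(QᵢΦ)(X;xᵢ=y)dy`; the sign of the momentum
  is immaterial below, all weights being even);
* `kinExcForm χ ℓ s u Φ = ∑ᵢ ℓ⁻³∫_{Λⁿ}∫ (4π²|p|² - (sℓ)⁻²)₊ |excAmp|² dp dX` — the form of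
  `∑ᵢ (T^{(i)} - bℓ⁻²Qᵢ) = ∑ᵢ Qᵢχ_Λ[-Δᵢ - s⁻²ℓ⁻²]₊χ_ΛQᵢ`, i.e. `kinBoxN` without its gap term:
  `kinExcForm + bℓ⁻²·nPlusBoxN ≤ kinBoxN` (`kinExcForm_add_le_kinBoxN`; equality needs only
  measurability, the inequality is unconditional);
* **(2.30), proved**: `(ℓ³/n) ∫ (4π²|p|² - (sℓ)⁻²)₊ ‖b_pΦ‖² dp ≤ ∑ᵢ⟨Φ,(T^{(i)} - bℓ⁻²Qᵢ)Φ⟩`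
  (`lintegral_tau_normSq_bVec_le`) — here by Cauchy–Schwarz in the particle sum,
  `|∑ᵢGᵢ|² ≤ n∑ᵢ|Gᵢ|²`, and Tonelli (the paper has the weaker factor `ℓ³/(n+1)` from `n₀ ≤ n`).

The remaining steps of the printed proof — the commutator bound (2.28), the pairing identity
(2.29), the bound (2.32), the completion of the square (2.33)–(2.36)
(`PeriodicBoseGasBogoliubovSquare.lean`) and the momentum integrals (2.37)–(2.42) — are for the
sibling files. **Caveat recorded for (2.29):** as printed it is an identity of `p`-integrals that
is not absolutely convergent for general `v ∈ L¹` and `L²` states (`‖b_p†Φ‖²` does not decay in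
`p`); a rigorous rendering needs an integrability hypothesis or a regularisation.

## References

* [Fournais2020] S. Fournais, *Length scales for BEC in the dilute Bose gas*, arXiv:2011.00309,
  EMS Ser. Congr. Rep. 18 (2021), doi:10.4171/ecr/18-1/7: (2.5)–(2.7), (2.15), Lemma 2.4,
  (2.27)–(2.30).
* [FournaisSolovej2020] S. Fournais, J. P. Solovej, *The energy of dilute Bose gases*,
  Ann. of Math. 192 (2020) 893–976: §§5–6, App. A.
-/

noncomputable section

open MeasureTheory
open scoped ENNReal NNReal FourierTransform ComplexConjugate

namespace Literature.MathematicalPhysics.QuantumManyBody.BoseGas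

variable {n : ℕ}

/-! ### The excited slices and their Fourier transforms -/

/-- The localised excited `i`-th slice `y ↦ χ_Λ(y) (Q Φ(X; ·ᵢ))(y)` of an `n`-body function on the
box `Λ(u)` (`χ_Λ = χ((·-u)/ℓ)`, `Q = Q_u` (3.5) = `1 - P` (2.5) on the slice). [cite: Fournais2020, (2.7), (2.27)] -/
def sliceExc (χ : Space → ℝ) (ℓ : ℝ) (u : Space) (i : Fin n) (Φ : Config n → ℂ) (X : Config n)
    (y : Space) : ℂ :=
  (locFun χ ℓ u y : ℂ) * projQ ℓ u (fun z => Φ (Function.update X i z)) y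

/-- The excitation amplitude `𝓕(χ_Λ QᵢΦ(X; ·ᵢ))(p)` of the `i`-th particle at momentum `2πp`
(the integrand of `T^{(i)}`, `kinLoc`). [cite: Fournais2020, (2.7), (2.27)] -/
def excAmp (χ : Space → ℝ) (ℓ : ℝ) (u : Space) (i : Fin n) (Φ : Config n → ℂ) (X : Config n)
    (p : Space) : ℂ :=
  𝓕 (sliceExc χ ℓ u i Φ X) p

/-- **The function `b_pΦ`** on `Λⁿ`: `ℓ⁻³ ∑ᵢ 𝓕(χ_Λ QᵢΦ(X;·ᵢ))(p)`, the first-quantised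
`b_{-k} = ℓ⁻³ a†(θ)a(Qχ_Λe^{ikx})` (2.27) at `k = 2πp` restricted to the `n`-particle sector
(`θ(xᵢ) = 1` on `Λ`; the `i`-th term does not depend on `xᵢ`). [cite: Fournais2020, (2.27)] -/
def bVec (χ : Space → ℝ) (ℓ : ℝ) (u : Space) (p : Space) (Φ : Config n → ℂ) (X : Config n) : ℂ :=
  ((ℓ ^ 3)⁻¹ : ℝ) • ∑ i : Fin n, excAmp χ ℓ u i Φ X p

/-- The form `∑ᵢ ⟨Φ, (T^{(i)} - bℓ⁻²Qᵢ)Φ⟩ = ∑ᵢ ℓ⁻³∫_{Λⁿ}∫(4π²|p|² - (sℓ)⁻²)₊|𝓕(χ_ΛQᵢΦ(X;·ᵢ))(p)|²dp dX`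
(the kinetic part of (2.6)–(2.7) without the gap `bℓ⁻²Q`, as in (2.30); cf. `kinBoxN`).
[cite: Fournais2020, (2.7), (2.30)] -/
def kinExcForm (χ : Space → ℝ) (ℓ s : ℝ) (u : Space) (Φ : Config n → ℂ) : ℝ≥0∞ :=
  ∑ i : Fin n, (ENNReal.ofReal ℓ ^ 3)⁻¹ *
    ∫⁻ X in boxConfig n ℓ u, ∫⁻ p : Space,
      ENNReal.ofReal (4 * Real.pi ^ 2 * ‖p‖ ^ 2 - (s * ℓ)⁻¹ ^ 2) * (‖excAmp χ ℓ u i Φ X p‖₊ : ℝ≥0∞) ^ 2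

/-! ### `T` splits into its excitation part and the gap -/

/-- `T^{(i)}` on a slice is the excitation part plus the gap term (definition of `kinLoc`).
[cite: Fournais2020, (2.7)] -/
theorem kinLoc_slice_eq (χ : Space → ℝ) (ℓ s b : ℝ) (u : Space) (i : Fin n) (Φ : Config n → ℂ)
    (X : Config n) :
    kinLoc χ ℓ s b u (fun z => Φ (Function.update X i z)) =
      (∫⁻ p : Space, ENNReal.ofReal (4 * Real.pi ^ 2 * ‖p‖ ^ 2 - (s * ℓ)⁻¹ ^ 2) *
          (‖excAmp χ ℓ u i Φ X p‖₊ : ℝ≥0∞) ^ 2) +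
        ENNReal.ofReal (b / ℓ ^ 2) *
          ∫⁻ x, (‖projQ ℓ u (fun z => Φ (Function.update X i z)) x‖₊ : ℝ≥0∞) ^ 2 :=
  rfl

/-- **`∑ᵢ(T^{(i)} - bℓ⁻²Qᵢ) + bℓ⁻² n₊ ≤ ∑ᵢ T^{(i)}`** as forms: `kinExcForm + bℓ⁻²·nPlusBoxN ≤ kinBoxN`
(termwise `∫A + c∫B ≤ ∫(A + cB)`; with measurability this is an equality). [cite: Fournais2020, (2.7), (2.30), (2.43)] -/
theorem kinExcForm_add_le_kinBoxN (χ : Space → ℝ) (ℓ s b : ℝ) (u : Space) (Φ : Config n → ℂ) :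
    kinExcForm χ ℓ s u Φ + ENNReal.ofReal (b / ℓ ^ 2) * nPlusBoxN ℓ u Φ ≤ kinBoxN χ ℓ s b u Φ := by
  unfold kinExcForm nPlusBoxN kinBoxN
  rw [Finset.mul_sum, ← Finset.sum_add_distrib]
  refine Finset.sum_le_sum fun i _ => ?_
  rw [mul_left_comm, ← mul_add]
  refine mul_le_mul_right ?_ _
  calc (∫⁻ X in boxConfig n ℓ u, ∫⁻ p : Space,
          ENNReal.ofReal (4 * Real.pi ^ 2 * ‖p‖ ^ 2 - (s * ℓ)⁻¹ ^ 2) * (‖excAmp χ ℓ u i Φ X p‖₊ : ℝ≥0∞) ^ 2) +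
        ENNReal.ofReal (b / ℓ ^ 2) *
          ∫⁻ X in boxConfig n ℓ u, ∫⁻ x, (‖projQ ℓ u (fun y => Φ (Function.update X i y)) x‖₊ : ℝ≥0∞) ^ 2
      ≤ (∫⁻ X in boxConfig n ℓ u, ∫⁻ p : Space,
          ENNReal.ofReal (4 * Real.pi ^ 2 * ‖p‖ ^ 2 - (s * ℓ)⁻¹ ^ 2) * (‖excAmp χ ℓ u i Φ X p‖₊ : ℝ≥0∞) ^ 2) +
        ∫⁻ X in boxConfig n ℓ u, ENNReal.ofReal (b / ℓ ^ 2) *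
          ∫⁻ x, (‖projQ ℓ u (fun y => Φ (Function.update X i y)) x‖₊ : ℝ≥0∞) ^ 2 :=
        add_le_add le_rfl (lintegral_const_mul_le _ _)
    _ ≤ ∫⁻ X in boxConfig n ℓ u, kinLoc χ ℓ s b u fun z => Φ (Function.update X i z) := by
        simp_rw [kinLoc_slice_eq]
        exact le_lintegral_add _ _

/-! ### Measurability -/

section Measurability

variable {χ : Space → ℝ} (hχ : Continuous χ) (ℓ : ℝ) (u : Space) (i : Fin n) {Φ : Config n → ℂ}
  (hΦ : Measurable Φ)
include hχ hΦ

omit hχ in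
/-- Joint measurability of `(X, y) ↦ (QᵢΦ)(X; xᵢ = y)` (slice-wise `Q_u`). [folklore] -/
theorem measurable_projQ_slice :
    Measurable fun r : Config n × Space => projQ ℓ u (fun z => Φ (Function.update r.1 i z)) r.2 := by
  have hsl : Measurable fun r : Config n × Space => Φ (Function.update r.1 i r.2) := hΦ.comp measurable_update'
  have hS : MeasurableSet {r : Config n × Space | r.2 ∈ slidingBox ℓ u} :=
    measurable_snd (measurableSet_slidingBox ℓ u)
  have hM : StronglyMeasurable fun X : Config n => ∫ y in slidingBox ℓ u, Φ (Function.update X i y) := by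
    have h := (hsl.stronglyMeasurable.indicator hS).integral_prod_right' (ν := (volume : Measure Space))
    have hfun : (fun X : Config n => ∫ y in slidingBox ℓ u, Φ (Function.update X i y)) =
        fun X => ∫ y, {r : Config n × Space | r.2 ∈ slidingBox ℓ u}.indicator
          (fun r => Φ (Function.update r.1 i r.2)) (X, y) := by
      funext X
      rw [← integral_indicator (measurableSet_slidingBox ℓ u)]
      rfl
    rw [hfun]
    exact h
  have hfun : (fun r : Config n × Space => projQ ℓ u (fun z => Φ (Function.update r.1 i z)) r.2) =
      {r : Config n × Space | r.2 ∈ slidingBox ℓ u}.indicator fun r =>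
        Φ (Function.update r.1 i r.2) - ((ℓ ^ 3)⁻¹ : ℝ) • ∫ y in slidingBox ℓ u, Φ (Function.update r.1 i y) := by
    funext r
    rfl
  rw [hfun]
  exact (hsl.sub ((hM.measurable.comp measurable_fst).const_smul ((ℓ ^ 3)⁻¹ : ℝ))).indicator hS

/-- Joint measurability of `(X, y) ↦ sliceExc … X y`. [folklore] -/
theorem measurable_sliceExc : Measurable fun r : Config n × Space => sliceExc χ ℓ u i Φ r.1 r.2 := by
  unfold sliceExc
  refine Measurable.mul ?_ (measurable_projQ_slice ℓ u i hΦ)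
  refine Complex.measurable_ofReal.comp ?_
  unfold locFun
  exact (hχ.measurable.comp (by fun_prop))

/-- **Joint measurability of `(X, p) ↦ excAmp … X p = 𝓕(χ_Λ QᵢΦ(X;·ᵢ))(p)`.** [folklore] -/
theorem measurable_excAmp : Measurable fun r : Config n × Space => excAmp χ ℓ u i Φ r.1 r.2 := by
  have hfun : (fun r : Config n × Space => excAmp χ ℓ u i Φ r.1 r.2) =
      fun r => ∫ y : Space, Complex.exp (↑(-2 * Real.pi * inner ℝ y r.2) * Complex.I) •
        sliceExc χ ℓ u i Φ r.1 y := by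
    funext r
    exact Real.fourier_eq' _ _
  rw [hfun]
  have hK : Continuous fun r : (Config n × Space) × Space =>
      Complex.exp (↑(-2 * Real.pi * inner ℝ r.2 r.1.2) * Complex.I) := by
    fun_prop
  have hp : Measurable fun r : (Config n × Space) × Space => (r.1.1, r.2) := by fun_prop
  have hF := (measurable_sliceExc hχ ℓ u i hΦ).comp hp
  exact (hK.stronglyMeasurable.smul hF.stronglyMeasurable).integral_prod_right'
    (ν := (volume : Measure Space)) |>.measurable

/-- Measurability of `(X, p) ↦ b_pΦ(X)`. [folklore] -/
theorem measurable_bVec : Measurable fun r : Config n × Space => bVec χ ℓ u r.2 Φ r.1 := by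
  unfold bVec
  exact (Finset.measurable_sum _ fun i _ => measurable_excAmp hχ ℓ u i hΦ).const_smul ((ℓ ^ 3)⁻¹ : ℝ)

end Measurability

/-! ### (2.30): the kinetic energy controls `∫ τ(p) ‖b_pΦ‖² dp` -/

/-- Pointwise Cauchy–Schwarz in the particle sum: `‖b_pΦ(X)‖² ≤ ℓ⁻⁶ n ∑ᵢ |𝓕(χ_ΛQᵢΦ(X;·ᵢ))(p)|²`.
[cite: Fournais2020, (2.30)] -/
theorem nnnorm_bVec_sq_le (χ : Space → ℝ) (ℓ : ℝ) (u : Space) (p : Space) (Φ : Config n → ℂ)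
    (X : Config n) :
    ((‖bVec χ ℓ u p Φ X‖₊ : ℝ≥0∞)) ^ 2 ≤
      ENNReal.ofReal (((ℓ ^ 3)⁻¹) ^ 2 * n) * ∑ i : Fin n, ((‖excAmp χ ℓ u i Φ X p‖₊ : ℝ≥0∞)) ^ 2 := by
  have key : ‖bVec χ ℓ u p Φ X‖ ^ 2 ≤ ((ℓ ^ 3)⁻¹ ^ 2 * n) * ∑ i : Fin n, ‖excAmp χ ℓ u i Φ X p‖ ^ 2 := by
    have hcs := norm_sum_sq_le (Finset.univ : Finset (Fin n)) fun i => excAmp χ ℓ u i Φ X p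
    simp only [Finset.card_univ, Fintype.card_fin] at hcs
    rw [bVec, norm_smul, Real.norm_eq_abs, mul_pow, sq_abs]
    calc ((ℓ ^ 3)⁻¹) ^ 2 * ‖∑ i : Fin n, excAmp χ ℓ u i Φ X p‖ ^ 2
        ≤ ((ℓ ^ 3)⁻¹) ^ 2 * (n * ∑ i : Fin n, ‖excAmp χ ℓ u i Φ X p‖ ^ 2) :=
          mul_le_mul_of_nonneg_left hcs (sq_nonneg _)
      _ = _ := by ring
  calc ((‖bVec χ ℓ u p Φ X‖₊ : ℝ≥0∞)) ^ 2 = ENNReal.ofReal (‖bVec χ ℓ u p Φ X‖ ^ 2) :=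
        coe_nnnorm_sq_eq_ofReal _
    _ ≤ ENNReal.ofReal (((ℓ ^ 3)⁻¹ ^ 2 * n) * ∑ i : Fin n, ‖excAmp χ ℓ u i Φ X p‖ ^ 2) :=
        ENNReal.ofReal_le_ofReal key
    _ = ENNReal.ofReal ((ℓ ^ 3)⁻¹ ^ 2 * n) * ∑ i : Fin n, ENNReal.ofReal (‖excAmp χ ℓ u i Φ X p‖ ^ 2) := by
        rw [ENNReal.ofReal_mul (by positivity), ENNReal.ofReal_sum_of_nonneg (fun i _ => sq_nonneg _)]
    _ = ENNReal.ofReal ((ℓ ^ 3)⁻¹ ^ 2 * n) * ∑ i : Fin n, ((‖excAmp χ ℓ u i Φ X p‖₊ : ℝ≥0∞)) ^ 2 := by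
        congr 1
        exact Finset.sum_congr rfl fun i _ => (coe_nnnorm_sq_eq_ofReal _).symm

/-- **Fournais 2020, (2.30), proved**: `(ℓ³/n)∫(4π²|p|² - (sℓ)⁻²)₊ ‖b_pΦ‖² dp ≤ ∑ᵢ⟨Φ,(T^{(i)} - bℓ⁻²Qᵢ)Φ⟩`,
in the form `∫ τ ‖b_pΦ‖²_{L²(Λⁿ)} dp ≤ n ℓ⁻³ · kinExcForm` (Cauchy–Schwarz in `∑ᵢ`, Tonelli).
[cite: Fournais2020, (2.30)] -/
theorem lintegral_tau_normSq_bVec_le {χ : Space → ℝ} (hχ : Continuous χ) {ℓ : ℝ} (hℓ : 0 < ℓ) (s : ℝ)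
    (u : Space) {Φ : Config n → ℂ} (hΦ : Measurable Φ) :
    ∫⁻ p : Space, ENNReal.ofReal (4 * Real.pi ^ 2 * ‖p‖ ^ 2 - (s * ℓ)⁻¹ ^ 2) *
        ∫⁻ X in boxConfig n ℓ u, ((‖bVec χ ℓ u p Φ X‖₊ : ℝ≥0∞)) ^ 2 ≤
      n * (ENNReal.ofReal ℓ ^ 3)⁻¹ * kinExcForm χ ℓ s u Φ := by
  set τ : Space → ℝ≥0∞ := fun p : Space => ENNReal.ofReal (4 * Real.pi ^ 2 * ‖p‖ ^ 2 - (s * ℓ)⁻¹ ^ 2) with hτ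
  have hτm : Measurable τ := ENNReal.measurable_ofReal.comp (by fun_prop)
  set c : ℝ≥0∞ := (ENNReal.ofReal ℓ ^ 3)⁻¹ with hc
  -- measurability of the slice amplitudes in `(p, X)` and of `b_pΦ(X)` in `X`
  have hG : ∀ i : Fin n, Measurable fun r : Space × Config n => ((‖excAmp χ ℓ u i Φ r.2 r.1‖₊ : ℝ≥0∞)) ^ 2 :=
    fun i => (((measurable_excAmp hχ ℓ u i hΦ).comp measurable_swap).nnnorm.coe_nnreal_ennreal).pow_const _
  have hB : ∀ p : Space, Measurable fun X : Config n => ((‖bVec χ ℓ u p Φ X‖₊ : ℝ≥0∞)) ^ 2 := fun p : Space =>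
    (((measurable_bVec hχ ℓ u hΦ).comp (measurable_prodMk_right (y := p))).nnnorm.coe_nnreal_ennreal).pow_const 2
  -- the dominating function `F(p, X) = ℓ⁻⁶ n ∑ᵢ τ(p) |Gᵢ(X, p)|²`
  set C : ℝ≥0∞ := ENNReal.ofReal (((ℓ ^ 3)⁻¹) ^ 2 * n) with hC
  have hCc : C = n * c * c := by
    rw [hC, hc, ENNReal.ofReal_mul (by positivity), ENNReal.ofReal_natCast, sq,
      ENNReal.ofReal_mul (by positivity), ENNReal.ofReal_inv_of_pos (by positivity), ENNReal.ofReal_pow hℓ.le]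
    ring
  have hFm : Measurable fun r : Space × Config n =>
      C * ∑ i : Fin n, τ r.1 * ((‖excAmp χ ℓ u i Φ r.2 r.1‖₊ : ℝ≥0∞)) ^ 2 :=
    Measurable.const_mul (Finset.measurable_sum _ fun i _ => (hτm.comp measurable_fst).mul (hG i)) _
  have hpt : ∀ p X, τ p * ((‖bVec χ ℓ u p Φ X‖₊ : ℝ≥0∞)) ^ 2 ≤
      C * ∑ i : Fin n, τ p * ((‖excAmp χ ℓ u i Φ X p‖₊ : ℝ≥0∞)) ^ 2 := by
    intro p X
    calc τ p * ((‖bVec χ ℓ u p Φ X‖₊ : ℝ≥0∞)) ^ 2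
        ≤ τ p * (C * ∑ i : Fin n, ((‖excAmp χ ℓ u i Φ X p‖₊ : ℝ≥0∞)) ^ 2) :=
          mul_le_mul_right (nnnorm_bVec_sq_le χ ℓ u p Φ X) _
      _ = C * ∑ i : Fin n, τ p * ((‖excAmp χ ℓ u i Φ X p‖₊ : ℝ≥0∞)) ^ 2 := by
          rw [Finset.mul_sum, Finset.mul_sum, Finset.mul_sum]
          exact Finset.sum_congr rfl fun i _ => by ring
  have hGX : ∀ (X : Config n) (i : Fin n), Measurable fun p : Space => ((‖excAmp χ ℓ u i Φ X p‖₊ : ℝ≥0∞)) ^ 2 :=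
    fun X i => (((measurable_excAmp hχ ℓ u i hΦ).comp (measurable_prodMk_left (x := X))).nnnorm.coe_nnreal_ennreal).pow_const 2
  have hmi : ∀ (X : Config n) (i : Fin n), Measurable fun p : Space => τ p * ((‖excAmp χ ℓ u i Φ X p‖₊ : ℝ≥0∞)) ^ 2 :=
    fun X i => hτm.mul (hGX X i)
  have hmX : ∀ i : Fin n, Measurable fun X : Config n => ∫⁻ p : Space, τ p * ((‖excAmp χ ℓ u i Φ X p‖₊ : ℝ≥0∞)) ^ 2 :=
    fun i => ((hτm.comp measurable_fst).mul (hG i)).lintegral_prod_left'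
  -- Step 1: push `τ` inside and dominate pointwise
  have h1 : ∫⁻ p : Space, τ p * ∫⁻ X in boxConfig n ℓ u, ((‖bVec χ ℓ u p Φ X‖₊ : ℝ≥0∞)) ^ 2 ≤
      ∫⁻ p : Space, ∫⁻ X in boxConfig n ℓ u, C * ∑ i : Fin n, τ p * ((‖excAmp χ ℓ u i Φ X p‖₊ : ℝ≥0∞)) ^ 2 := by
    refine lintegral_mono fun p : Space => ?_
    rw [← lintegral_const_mul _ (hB p)]
    exact lintegral_mono fun X => hpt p X
  -- Step 2: Tonelli
  have h2 : ∫⁻ p : Space, ∫⁻ X in boxConfig n ℓ u, C * ∑ i : Fin n, τ p * ((‖excAmp χ ℓ u i Φ X p‖₊ : ℝ≥0∞)) ^ 2 =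
      ∫⁻ X in boxConfig n ℓ u, ∫⁻ p : Space, C * ∑ i : Fin n, τ p * ((‖excAmp χ ℓ u i Φ X p‖₊ : ℝ≥0∞)) ^ 2 :=
    lintegral_lintegral_swap hFm.aemeasurable
  -- Step 3: linearity in `p`, then in `X`
  have h3 : ∀ X : Config n, ∫⁻ p : Space, C * ∑ i : Fin n, τ p * ((‖excAmp χ ℓ u i Φ X p‖₊ : ℝ≥0∞)) ^ 2 =
      C * ∑ i : Fin n, ∫⁻ p : Space, τ p * ((‖excAmp χ ℓ u i Φ X p‖₊ : ℝ≥0∞)) ^ 2 := by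
    intro X
    rw [lintegral_const_mul' _ _ ENNReal.ofReal_ne_top, lintegral_finsetSum _ fun i _ => hmi X i]
  have h4 : ∫⁻ X in boxConfig n ℓ u, C * ∑ i : Fin n, ∫⁻ p : Space, τ p * ((‖excAmp χ ℓ u i Φ X p‖₊ : ℝ≥0∞)) ^ 2 =
      C * ∑ i : Fin n, ∫⁻ X in boxConfig n ℓ u, ∫⁻ p : Space, τ p * ((‖excAmp χ ℓ u i Φ X p‖₊ : ℝ≥0∞)) ^ 2 := by
    rw [lintegral_const_mul' _ _ ENNReal.ofReal_ne_top, lintegral_finsetSum _ fun i _ => hmX i]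
  -- Step 4: identify `kinExcForm`
  have h5 : C * ∑ i : Fin n, ∫⁻ X in boxConfig n ℓ u, ∫⁻ p : Space, τ p * ((‖excAmp χ ℓ u i Φ X p‖₊ : ℝ≥0∞)) ^ 2 =
      n * c * kinExcForm χ ℓ s u Φ := by
    rw [hCc, kinExcForm, Finset.mul_sum, Finset.mul_sum]
    refine Finset.sum_congr rfl fun i _ => ?_
    rw [← hc]
    ring
  refine h1.trans ?_
  rw [h2, lintegral_congr h3, h4, h5]

end Literature.MathematicalPhysics.QuantumManyBody.BoseGas

end
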